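import Summits.QuantumFields.YangMills.Theorems.BalabanUVNodesSpineReadingOfRecord13CoPHKComponentSizeBlocksInside

/-!
# THE INSIDE-EVENT FACE AT THE LEVEL-WINDOW KEY READING `windowKeyReading₁₃ K₀ c`: the window key forgets the entries at the levels `1 ≤ j ≤ c … K` (region `∅`) and keeps
# the others verbatim, so its large-field regions stay block-saturated — the saturation hypothesis `hsat` of `…BlocksInside` DISCHARGED at every floor reading `c`

Cell `pub-ymgap`, YM-PLAN Track A (HUMAN RULING D-0062; width push D-0149); seat `pub-ymgap-dag-n20-d` (R134 (a) N20 NE7b s3 = the U5d ∕ `crOfRecord₁₃` lineage, its declarer)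
gen 33; companion of `…CoPHKComponentSizeBlocksInside` (gen 33: `blockSaturated_of_mem_classSet₁₃`, `relWeightBound_card_of_insideBlockEnergyLetters_geometric`) and of the
K-kit's window reading (`…CoPHK` §6 `windowKeyReading₁₃`, `Node00.windowKeySigma ∕ windowKey` of `Node00/TwoRunSiteWindow`; floor `0` = the identity reading,
`windowKeyReading₁₃_zero`).  `--kind proof --supports stmt-QuantumFields-27366 --as helper` (K3⁸); COUNT-NEUTRAL; THEOREMS ONLY (0 `def`).
WHY.  `…BlocksInside` discharges its saturation hypothesis `hsat` at the identity reading only; the K-kit's consumers (`…CoPHKTower`, `…KFloorVolume`, the window roads of the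
n19∕n20-w lanes) read the record through the LEVEL WINDOW `windowKeyReading₁₃ K₀ c` (floor `c … K` per tuple and step).  The window key's `j`-th small-field entry is `univ` for
`1 ≤ j ≤ c` (large-field region `∅`, saturated vacuously) and the record's entry otherwise (saturated by `blockSaturated_of_mem_classSet₁₃`), so `hsat` holds at EVERY floor reading
and the INSIDE block energy letters give the N20 face there too.
WHAT IS HERE.  §1 `blockSaturated_compl_windowKey_snd` (generic: the window keeps saturation of every complement entry) and ★ `hsat_windowKeyReading₁₃_of_dvd ∕ hsat_windowKeyReading₁₃`
(the `hsat` shape at the window reading, modulo the two cube-side divisibilities ∕ none for `lv K j ≤ j`); §2 ★★★ `relWeightBound_card_of_insideBlockEnergyLetters_window_of_dvd` and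
★★★ `relWeightBound_card_of_insideBlockEnergyLetters_window` (INSIDE block letters at the window reading's coarse classes, uniformly small, threshold schedule ⇒ `RelWeightBound` with
the geometric weight `δ₀ · 2^{−(K+1)}`; at floor `0` these are `…BlocksInside`'s `_id_of_dvd ∕ _id`).
HONEST FRAMING.  [folklore] bookkeeping BY NAME; the INSIDE block energy letters are HYPOTHESES (inhabited for no family today; NOT PRINTED as two-run statements; LCS-shaped;
print's per-size factors are (1.85)'s `γ₀A₁p₀²(g_{j+1})(d′+1)` for NEW regions ∕ (1.89)'s `κ₁d_k(X)`, ABSOLUTE per term, not relative — see `…BlocksInside` v1.1 ERRATUM);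
NO weight is bounded, NO estimate proved; nothing of Bałaban's asserted; NE7 ∕ NE7b ∕ NE7c NOT PRINTED for `d = 4` ∕ NOT proved; no `Provisos₁₃CoPH` inhabitant claimed (K0⁷ OPEN);
K3⁸ v7 untouched; N19 ∕ N20 ∕ N21 ∕ N27 NOT discharged; counts UNMOVED (typed 28∕28 · discharged 8∕27); one finite four-torus programme at fixed `ε` — NOT ℝ⁴, NOT OS, NOT a mass gap,
NOT the Clay problem.  No `def`, no `instance`, no `notation`, no `sorry`; no cite tags below.
-/

noncomputable section

open scoped BigOperators
open Finset

namespace YMDAG.UVSplit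

open Literature.MathematicalPhysics.QuantumFieldTheory.Balaban1983to89
open Literature.MathematicalPhysics.QuantumFieldTheory.Balaban1983to89.T4Continuum
open Literature.MathematicalPhysics.QuantumFieldTheory.Balaban1983to89.Node00
open Literature.MathematicalPhysics.QuantumFieldTheory.Balaban1983to89.B5Eq118OneStroke (iterBlockOf iterBlock)
open T4WeightBudget (RelWeightBound)

variable {F : T4Family} {N : ℕ} [NeZero N]

/-! ## §1 The window key keeps saturation; `hsat` at the window reading -/

section Saturation

variable (θ : Stage13HParams F N) (hP : θ.Provisos₁₃CoPH F N) (K₀ : ℕ) (g₀ : ℕ → ℝ) (os : List (ULoop F))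

/-- **THE WINDOW KEEPS SATURATION OF THE LARGE-FIELD REGIONS**: the `j`-th large-field region of `windowKey c x` is `∅` (`1 ≤ j ≤ c`) or that of `x` (otherwise), so if
`(x.2 j)ᶜ` is `ℓ`-block-saturated then so is `((windowKey c x).2 j)ᶜ`. [bookkeeping] -/
theorem blockSaturated_compl_windowKey_snd {Kc ℓ : ℕ} (c j : ℕ) (x : SiteSeqKey F Kc)
    (hx : ∀ ⦃z z' : Site (F.P Kc) 0⦄, iterBlockOf ℓ z = iterBlockOf ℓ z' → z ∈ (x.2 j)ᶜ → z' ∈ (x.2 j)ᶜ) :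
    ∀ ⦃z z' : Site (F.P Kc) 0⦄, iterBlockOf ℓ z = iterBlockOf ℓ z' → z ∈ ((windowKey c x).2 j)ᶜ → z' ∈ ((windowKey c x).2 j)ᶜ := by
  intro z z' hzz hz
  rw [windowKey_snd] at hz ⊢
  by_cases h : 1 ≤ j ∧ j ≤ c
  · rw [if_pos h] at hz
    exact absurd (Set.mem_univ z) hz
  · rw [if_neg h] at hz ⊢
    exact hx hzz hz

/-- ★ **`hsat` AT THE WINDOW READING, modulo the two cube-side divisibilities**: every coarse class of `windowKeyReading₁₃ K₀ c` at step `K` is the window key of a class of record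
`⟨K, x⟩`, whose regions are `lv K j`-block-saturated when `L^{lv K j}` divides both runs' level-`j` cube sides (`blockSaturated_of_mem_classSet₁₃`). [bookkeeping] -/
theorem hsat_windowKeyReading₁₃_of_dvd (c : FloorReading₁₃ N) (lv : ℕ → ℕ → ℕ) (hlv : ∀ K j, lv K j ≤ F.m + (K₀ + K)) (K j : ℕ)
    (hdvA : F.L ^ lv K j ∣ dCubeSide F.L θ.τ9.M (RkOfRecord F.L θ.ν.r (histA₁₃ θ K₀ g₀ K j)) j)
    (hdvB : F.L ^ lv K j ∣ dCubeSide F.L θ.τ9.M (RkOfRecord F.L θ.ν.r (histB₁₃ θ K₀ g₀ K (j + 1))) j) :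
    ∀ u ∈ classSetK₁₃ θ K₀ g₀ (windowKeyReading₁₃ K₀ c F θ hP g₀ os) K, ∀ y : SiteSeqKey F (K₀ + K), u = ⟨K, y⟩ →
      ∀ ⦃z z' : Site (F.P (K₀ + K)) 0⦄, iterBlockOf (lv K j) z = iterBlockOf (lv K j) z' → z ∈ (y.2 j)ᶜ → z' ∈ (y.2 j)ᶜ := by
  intro u hu y hy
  obtain ⟨x, hx, hxu⟩ := (mem_classSetK₁₃_iff θ K₀ g₀ _ K u).1 hu
  obtain ⟨K', x2⟩ := x
  have hK' : K' = K := fst_eq_of_mem_classSet₁₃ θ K₀ g₀ hx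
  subst hK'
  -- `u = ⟨K', windowKey (c … K') x2⟩ = ⟨K', y⟩`
  have hwin : windowKeyReading₁₃ K₀ c F θ hP g₀ os K' ⟨K', x2⟩ = ⟨K', windowKey (c F θ hP g₀ os K') x2⟩ := rfl
  rw [hwin] at hxu
  have hyx : y = windowKey (c F θ hP g₀ os K') x2 := (eq_of_heq (Sigma.mk.inj (hxu.trans hy)).2).symm
  rw [hyx]
  exact blockSaturated_compl_windowKey_snd (c F θ hP g₀ os K') j x2 (blockSaturated_of_mem_classSet₁₃ θ K₀ g₀ K' (hlv K' j) hdvA hdvB hx)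

/-- ★ … and for block levels `lv K j ≤ j` with NO divisibility hypothesis. [bookkeeping] -/
theorem hsat_windowKeyReading₁₃ (c : FloorReading₁₃ N) (lv : ℕ → ℕ → ℕ) (hlv : ∀ K j, lv K j ≤ F.m + (K₀ + K)) (K j : ℕ) (hlvj : lv K j ≤ j) :
    ∀ u ∈ classSetK₁₃ θ K₀ g₀ (windowKeyReading₁₃ K₀ c F θ hP g₀ os) K, ∀ y : SiteSeqKey F (K₀ + K), u = ⟨K, y⟩ →
      ∀ ⦃z z' : Site (F.P (K₀ + K)) 0⦄, iterBlockOf (lv K j) z = iterBlockOf (lv K j) z' → z ∈ (y.2 j)ᶜ → z' ∈ (y.2 j)ᶜ :=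
  hsat_windowKeyReading₁₃_of_dvd θ hP K₀ g₀ os c lv hlv K j (pow_dvd_dCubeSide_of_le _ _ _ hlvj) (pow_dvd_dCubeSide_of_le _ _ _ hlvj)

/-- The window reading is step-preserving on the class set of record (`windowKeySigma_fst` + `fst_eq_of_mem_classSet₁₃`). [bookkeeping] -/
theorem fst_windowKeyReading₁₃_of_mem_classSet₁₃ (c : FloorReading₁₃ N) (K : ℕ) (x : Σ K, SiteSeqKey F (K₀ + K)) (hx : x ∈ classSet₁₃ θ K₀ g₀ K) :
    (windowKeyReading₁₃ K₀ c F θ hP g₀ os K x).1 = K := by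
  show (windowKeySigma F (c F θ hP g₀ os) x).1 = K
  rw [windowKeySigma_fst]
  exact fst_eq_of_mem_classSet₁₃ θ K₀ g₀ hx

end Saturation

/-! ## §2 The face from INSIDE block energy letters at the window reading -/

section Face

variable (θ : Stage13HParams F N) (hP : θ.Provisos₁₃CoPH F N) (K₀ : ℕ) (g₀ : ℕ → ℝ) (os : List (ULoop F)) (c : FloorReading₁₃ N) (jcut : ℕ → ℕ)
  (n lv : ℕ → ℕ → ℕ)

/-- ★★★ **THE N20 FACE AT THE WINDOW READING FROM INSIDE BLOCK ENERGY LETTERS**, block levels as coarse as the divisibilities `L^{lv K j} ∣ L^j · M · R_j` of the two runs allow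
(`1 ≤ j ≤ jcut K`): uniformly small INSIDE letters (`0 ≤ δ K j ≤ δ₀`, `2·(3^4 − 1)²·δ₀ ≤ 1`) at the coarse classes of `windowKeyReading₁₃ K₀ c` in both runs, under the threshold
schedule `n K j ≥ ⌈log₂ |Site_{lv K j}|⌉ + K + j + 3`, give `RelWeightBound` at the window reading's carriers with the geometric weight `δ₀ · 2^{−(K+1)}`. [bookkeeping] -/
theorem relWeightBound_card_of_insideBlockEnergyLetters_window_of_dvd
    {δ : ℕ → ℕ → ℝ} {δ₀ : ℝ} (hδ0 : ∀ K j, 0 ≤ δ K j) (hδ1 : ∀ K j, δ K j ≤ δ₀) (hD : 2 * ((3 : ℝ) ^ 4 - 1) ^ 2 * δ₀ ≤ 1)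
    (hn : ∀ K j, Nat.clog 2 (Fintype.card (Site (F.P (K₀ + K)) (lv K j))) + K + j + 3 ≤ n K j) (hlv : ∀ K j, lv K j ≤ F.m + (K₀ + K))
    (hdvA : ∀ K, ∀ j ∈ Finset.Icc 1 (jcut K), F.L ^ lv K j ∣ dCubeSide F.L θ.τ9.M (RkOfRecord F.L θ.ν.r (histA₁₃ θ K₀ g₀ K j)) j)
    (hdvB : ∀ K, ∀ j ∈ Finset.Icc 1 (jcut K), F.L ^ lv K j ∣ dCubeSide F.L θ.τ9.M (RkOfRecord F.L θ.ν.r (histB₁₃ θ K₀ g₀ K (j + 1))) j)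
    (hEA : ∀ (K : ℕ) (t : ℝ), |t| ≤ 1 → ∀ j ∈ Finset.Icc 1 (jcut K), ∀ p ∈ animalCoverFamily (SiteTouch (P := F.P (K₀ + K)) (j := lv K j)) (n K j),
      ∑ u ∈ badClassK₁₃ θ K₀ g₀ (windowKeyReading₁₃ K₀ c F θ hP g₀ os) (fun _ u => ∀ y : SiteSeqKey F (K₀ + K), u = ⟨K, y⟩ →
          ∀ b ∈ p.2, (↑(iterBlock (lv K j) b) : Set (Site (F.P (K₀ + K)) 0)) ⊆ (y.2 j)ᶜ) K t,
          weightAK₁₃ θ hP K₀ g₀ os (windowKeyReading₁₃ K₀ c F θ hP g₀ os) K t u ≤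
        δ K j ^ n K j * ∑ u ∈ classSetK₁₃ θ K₀ g₀ (windowKeyReading₁₃ K₀ c F θ hP g₀ os) K, weightAK₁₃ θ hP K₀ g₀ os (windowKeyReading₁₃ K₀ c F θ hP g₀ os) K t u)
    (hEB : ∀ (K : ℕ) (t : ℝ), |t| ≤ 1 → ∀ j ∈ Finset.Icc 1 (jcut K), ∀ p ∈ animalCoverFamily (SiteTouch (P := F.P (K₀ + K)) (j := lv K j)) (n K j),
      ∑ u ∈ badClassK₁₃ θ K₀ g₀ (windowKeyReading₁₃ K₀ c F θ hP g₀ os) (fun _ u => ∀ y : SiteSeqKey F (K₀ + K), u = ⟨K, y⟩ →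
          ∀ b ∈ p.2, (↑(iterBlock (lv K j) b) : Set (Site (F.P (K₀ + K)) 0)) ⊆ (y.2 j)ᶜ) K t,
          weightBK₁₃ θ hP K₀ g₀ os (windowKeyReading₁₃ K₀ c F θ hP g₀ os) K t u ≤
        δ K j ^ n K j * ∑ u ∈ classSetK₁₃ θ K₀ g₀ (windowKeyReading₁₃ K₀ c F θ hP g₀ os) K, weightBK₁₃ θ hP K₀ g₀ os (windowKeyReading₁₃ K₀ c F θ hP g₀ os) K t u) :
    RelWeightBound 1 (classSetK₁₃ θ K₀ g₀ (windowKeyReading₁₃ K₀ c F θ hP g₀ os)) (weightAK₁₃ θ hP K₀ g₀ os (windowKeyReading₁₃ K₀ c F θ hP g₀ os))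
      (weightBK₁₃ θ hP K₀ g₀ os (windowKeyReading₁₃ K₀ c F θ hP g₀ os))
      (badClassK₁₃ θ K₀ g₀ (windowKeyReading₁₃ K₀ c F θ hP g₀ os)
        (badKeyReadingOfBigComponent₁₃ N K₀ jcut (bigDialOfCard₁₃ K₀ (fun K j => n K j * (F.L ^ 4) ^ lv K j)) F θ hP g₀ os))
      (fun K => δ₀ * (1 / 2) ^ (K + 1)) :=
  relWeightBound_card_of_insideBlockEnergyLetters_geometric θ hP K₀ g₀ os (windowKeyReading₁₃ K₀ c F θ hP g₀ os) jcut n lv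
    (fun K x hx => fst_windowKeyReading₁₃_of_mem_classSet₁₃ θ hP K₀ g₀ os c K x hx) hδ0 hδ1 hD hn hlv
    (fun K j hj => hsat_windowKeyReading₁₃_of_dvd θ hP K₀ g₀ os c lv hlv K j (hdvA K j hj) (hdvB K j hj)) hEA hEB

/-- ★★★ **… BLOCK LEVELS `lv K j ≤ j`: NO SATURATION ∕ DIVISIBILITY HYPOTHESIS LEFT** at the window reading `windowKeyReading₁₃ K₀ c` (any floor reading `c`; floor `0` =
`…BlocksInside`'s `relWeightBound_card_of_insideBlockEnergyLetters_id` by `windowKeyReading₁₃_zero`). [bookkeeping] -/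
theorem relWeightBound_card_of_insideBlockEnergyLetters_window
    {δ : ℕ → ℕ → ℝ} {δ₀ : ℝ} (hδ0 : ∀ K j, 0 ≤ δ K j) (hδ1 : ∀ K j, δ K j ≤ δ₀) (hD : 2 * ((3 : ℝ) ^ 4 - 1) ^ 2 * δ₀ ≤ 1)
    (hn : ∀ K j, Nat.clog 2 (Fintype.card (Site (F.P (K₀ + K)) (lv K j))) + K + j + 3 ≤ n K j) (hlv : ∀ K j, lv K j ≤ F.m + (K₀ + K))
    (hlvj : ∀ K, ∀ j ∈ Finset.Icc 1 (jcut K), lv K j ≤ j)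
    (hEA : ∀ (K : ℕ) (t : ℝ), |t| ≤ 1 → ∀ j ∈ Finset.Icc 1 (jcut K), ∀ p ∈ animalCoverFamily (SiteTouch (P := F.P (K₀ + K)) (j := lv K j)) (n K j),
      ∑ u ∈ badClassK₁₃ θ K₀ g₀ (windowKeyReading₁₃ K₀ c F θ hP g₀ os) (fun _ u => ∀ y : SiteSeqKey F (K₀ + K), u = ⟨K, y⟩ →
          ∀ b ∈ p.2, (↑(iterBlock (lv K j) b) : Set (Site (F.P (K₀ + K)) 0)) ⊆ (y.2 j)ᶜ) K t,
          weightAK₁₃ θ hP K₀ g₀ os (windowKeyReading₁₃ K₀ c F θ hP g₀ os) K t u ≤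
        δ K j ^ n K j * ∑ u ∈ classSetK₁₃ θ K₀ g₀ (windowKeyReading₁₃ K₀ c F θ hP g₀ os) K, weightAK₁₃ θ hP K₀ g₀ os (windowKeyReading₁₃ K₀ c F θ hP g₀ os) K t u)
    (hEB : ∀ (K : ℕ) (t : ℝ), |t| ≤ 1 → ∀ j ∈ Finset.Icc 1 (jcut K), ∀ p ∈ animalCoverFamily (SiteTouch (P := F.P (K₀ + K)) (j := lv K j)) (n K j),
      ∑ u ∈ badClassK₁₃ θ K₀ g₀ (windowKeyReading₁₃ K₀ c F θ hP g₀ os) (fun _ u => ∀ y : SiteSeqKey F (K₀ + K), u = ⟨K, y⟩ →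
          ∀ b ∈ p.2, (↑(iterBlock (lv K j) b) : Set (Site (F.P (K₀ + K)) 0)) ⊆ (y.2 j)ᶜ) K t,
          weightBK₁₃ θ hP K₀ g₀ os (windowKeyReading₁₃ K₀ c F θ hP g₀ os) K t u ≤
        δ K j ^ n K j * ∑ u ∈ classSetK₁₃ θ K₀ g₀ (windowKeyReading₁₃ K₀ c F θ hP g₀ os) K, weightBK₁₃ θ hP K₀ g₀ os (windowKeyReading₁₃ K₀ c F θ hP g₀ os) K t u) :
    RelWeightBound 1 (classSetK₁₃ θ K₀ g₀ (windowKeyReading₁₃ K₀ c F θ hP g₀ os)) (weightAK₁₃ θ hP K₀ g₀ os (windowKeyReading₁₃ K₀ c F θ hP g₀ os))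
      (weightBK₁₃ θ hP K₀ g₀ os (windowKeyReading₁₃ K₀ c F θ hP g₀ os))
      (badClassK₁₃ θ K₀ g₀ (windowKeyReading₁₃ K₀ c F θ hP g₀ os)
        (badKeyReadingOfBigComponent₁₃ N K₀ jcut (bigDialOfCard₁₃ K₀ (fun K j => n K j * (F.L ^ 4) ^ lv K j)) F θ hP g₀ os))
      (fun K => δ₀ * (1 / 2) ^ (K + 1)) :=
  relWeightBound_card_of_insideBlockEnergyLetters_window_of_dvd θ hP K₀ g₀ os c jcut n lv hδ0 hδ1 hD hn hlv
    (fun K j hj => pow_dvd_dCubeSide_of_le _ _ _ (hlvj K j hj)) (fun K j hj => pow_dvd_dCubeSide_of_le _ _ _ (hlvj K j hj)) hEA hEB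

end Face

end YMDAG.UVSplit

end
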